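import Summits.Parity.GeneralizedHardyLittlewood.Theorems.ChenParityOracleBLAPHostParityFromBrickVaughanBlock
import Literature.NumberTheory.Sieve.VaughanMeanValueDecomposition
import HarnessLib

/-!
# Route `ChenParityOracleBLAP` — crux S1 = `HostParityFromBrick` (stmt-Parity-20045): Vaughan's Type-II pieces

Support file for the prime half `K1 → K2 → HP1` of S1 (step (V)).  The Type-II pieces of Vaughan's
identity against `h_d(k) = 1_{(k,P)=1}[d ∣ k+2]λ(k+2)` are cut into dyadic blocks
(`sum_Ioc_dyadic`) and each block is bounded by `typeII_block_le` from the hyperbolic Type-II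
bound `HTII` (hypothesis; the shape of `typeII_hyperbolic_static`, uniform over the admissible
dyadic `M` and all `V₀`):
* `sum_abs_T2b_le` — `c_U` piece, `U < b ≤ U²`: `≤ J (log x) X₂`;
* `sum_abs_T3_le` — `G_U ⋆ F_U` piece (`m, n > U`, `mn ≤ y`), split at `√y` with the roles of the
  variables exchanged above `√y` (`sum_hyperbolic_comm`): `≤ 2J (log x)² X₂`;
here `J = Nat.log 2 x + 1` bounds the number of dyadic blocks.

References: R. C. Vaughan, Acta Arith. 37 (1980) [Vaughan1980]; H. Iwaniec, E. Kowalski,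
*Analytic Number Theory* (2004), §13.4 [IwaniecKowalski2004].
-/

namespace Summit.Parity.GeneralizedHardyLittlewood.Theorems

open Finset Real
open ArithmeticFunction
open Literature.NumberTheory.Sieve.Vaughan (cU gU abs_cU_le_log abs_gU_le gU_eq_zero_of_le)

/-- **Dyadic assembly of Type-II blocks.**  If every admissible block (`U·2^j < x`-ish: those with
`U 2^j < T`) is bounded by `Bk` and the summand vanishes for `b > T`, then
`∑_d |∑_{U<b≤T} F_d(b)| ≤ J · Bk` with `J = Nat.log 2 T + 1`. -/
theorem sum_abs_dyadic_le {U T : ℕ} (hU : 1 ≤ U) (Dset : Finset ℕ) (F : ℕ → ℕ → ℝ) {Bk : ℝ}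
    (hBk : 0 ≤ Bk)
    (hblock : ∀ j : ℕ, U * 2 ^ j < T →
      ∑ d ∈ Dset, |∑ b ∈ Ioc (U * 2 ^ j) (2 * (U * 2 ^ j)), if b ≤ T then F d b else 0| ≤ Bk) :
    ∑ d ∈ Dset, |∑ b ∈ Ioc U T, F d b| ≤ (Nat.log 2 T + 1 : ℕ) * Bk := by
  classical
  set J : ℕ := Nat.log 2 T + 1 with hJ
  have hTJ : T ≤ U * 2 ^ J := by
    have : T < 2 ^ J := Nat.lt_pow_succ_log_self (by norm_num) T
    nlinarith
  -- extend `F d` by zero beyond `T` and pass to the dyadic range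
  have hext : ∀ d, ∑ b ∈ Ioc U T, F d b = ∑ b ∈ Ioc U (U * 2 ^ J), if b ≤ T then F d b else 0 := by
    intro d
    rw [← Finset.sum_filter]
    refine Finset.sum_congr ?_ fun _ _ => rfl
    ext b; simp only [Finset.mem_Ioc, Finset.mem_filter]; omega
  simp only [hext, sum_Ioc_dyadic]
  calc ∑ d ∈ Dset, |∑ j ∈ range J, ∑ b ∈ Ioc (U * 2 ^ j) (2 * (U * 2 ^ j)), if b ≤ T then F d b else 0|
      ≤ ∑ d ∈ Dset, ∑ j ∈ range J, |∑ b ∈ Ioc (U * 2 ^ j) (2 * (U * 2 ^ j)),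
          if b ≤ T then F d b else 0| := Finset.sum_le_sum fun d _ => Finset.abs_sum_le_sum_abs _ _
    _ = ∑ j ∈ range J, ∑ d ∈ Dset, |∑ b ∈ Ioc (U * 2 ^ j) (2 * (U * 2 ^ j)),
          if b ≤ T then F d b else 0| := Finset.sum_comm
    _ ≤ ∑ j ∈ range J, Bk := by
        refine Finset.sum_le_sum fun j _ => ?_
        by_cases hj : U * 2 ^ j < T
        · exact hblock j hj
        · -- empty block: all `b > T`
          have : ∀ d ∈ Dset, |∑ b ∈ Ioc (U * 2 ^ j) (2 * (U * 2 ^ j)),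
              if b ≤ T then F d b else 0| = 0 := by
            intro d _
            rw [abs_eq_zero]
            refine Finset.sum_eq_zero fun b hb => ?_
            rw [Finset.mem_Ioc] at hb
            rw [if_neg (by omega)]
          rw [Finset.sum_congr rfl this, Finset.sum_const_zero]; exact hBk
    _ = (Nat.log 2 T + 1 : ℕ) * Bk := by rw [Finset.sum_const, Finset.card_range, nsmul_eq_mul]

/-- **The Type-II piece `T₂b`** (`c_U`, `U < b ≤ U²`).  For `1 ≤ U`, `U² ≤ x`, `2U² ≤ x^{2/3}`,
`ρ(x^{1/3−δ}+1) ≤ U`, `2 ≤ x`, and the hyperbolic Type-II bound `HTII` (uniform `X₂ ≥ 0`):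
`∑_d |∑_{U<b≤U²} c_U(b) ∑_{t ≤ y/b} h_d(bt)| ≤ (Nat.log 2 (U²) + 1) (log x) X₂`. -/
theorem sum_abs_T2b_le {x y U P N : ℕ} (hP : P = primorial (N - 1)) {w₀ ρ δ : ℝ} (hw : w₀ ≤ N)
    (hx : 2 ≤ x) (hU : 1 ≤ U) (hUU : U * U ≤ x)
    (hUlo : ρ * ((x : ℝ) ^ (1 / 3 - δ) + 1) ≤ U) (hUhi : 2 * ((U * U : ℕ) : ℝ) ≤ (x : ℝ) ^ (2 / 3 : ℝ))
    (Dset : Finset ℕ) {X₂ : ℝ} (hX₂ : 0 ≤ X₂)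
    (HTII : ∀ M V₀ : ℕ, ρ * ((x : ℝ) ^ (1 / 3 - δ) + 1) ≤ M → 2 * (M : ℝ) ≤ (x : ℝ) ^ (2 / 3 : ℝ) →
      ∀ α β : ℕ → ℝ, (∀ n, |α n| ≤ 1) → (∀ n, |β n| ≤ 1) →
      (∀ n, α n ≠ 0 → ∀ p ∈ n.primeFactors, w₀ ≤ (p : ℝ)) →
      (∀ n, β n ≠ 0 → ∀ p ∈ n.primeFactors, w₀ ≤ (p : ℝ)) →
      ∑ d ∈ Dset, |∑ m ∈ Ioc M (2 * M), ∑ n ∈ Ioc V₀ (y / m),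
        α m * β n * (if d ∣ m * n + 2 then (liouville (m * n + 2) : ℝ) else 0)| ≤ X₂) :
    ∑ d ∈ Dset, |∑ b ∈ Ioc U (U * U), cU U b * ∑ t ∈ Ioc 0 (y / b),
        ((if Nat.Coprime (b * t) P then (1 : ℝ) else 0) *
          (if d ∣ b * t + 2 then (liouville (b * t + 2) : ℝ) else 0))| ≤
      (Nat.log 2 (U * U) + 1 : ℕ) * (Real.log x * X₂) := by
  classical
  have hlog : 0 < Real.log x := Real.log_pos (by exact_mod_cast hx)
  refine sum_abs_dyadic_le hU Dset (fun d b => cU U b * ∑ t ∈ Ioc 0 (y / b),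
    ((if Nat.Coprime (b * t) P then (1 : ℝ) else 0) *
      (if d ∣ b * t + 2 then (liouville (b * t + 2) : ℝ) else 0))) (by positivity) ?_
  intro j hj
  set M : ℕ := U * 2 ^ j with hM
  -- block conditions
  have hMlo : ρ * ((x : ℝ) ^ (1 / 3 - δ) + 1) ≤ M := by
    refine hUlo.trans ?_
    exact_mod_cast Nat.le_mul_of_pos_right U (by positivity)
  have hMhi : 2 * (M : ℝ) ≤ (x : ℝ) ^ (2 / 3 : ℝ) := by
    have : 2 * (M : ℝ) ≤ 2 * ((U * U : ℕ) : ℝ) := by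
      have := hj.le; exact_mod_cast Nat.mul_le_mul_left 2 this
    exact this.trans hUhi
  -- rewrite `if b ≤ U² then c_U b * S else 0 = (if b ≤ U² then c_U b else 0) * S`
  have hF : ∀ d, ∑ b ∈ Ioc M (2 * M), (if b ≤ U * U then cU U b * ∑ t ∈ Ioc 0 (y / b),
      ((if Nat.Coprime (b * t) P then (1 : ℝ) else 0) *
        (if d ∣ b * t + 2 then (liouville (b * t + 2) : ℝ) else 0)) else 0) =
      ∑ b ∈ Ioc M (2 * M), (if b ≤ U * U then cU U b else 0) * ∑ t ∈ Ioc 0 (y / b), (1 : ℝ) *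
      ((if Nat.Coprime (b * t) P then (1 : ℝ) else 0) *
        (if d ∣ b * t + 2 then (liouville (b * t + 2) : ℝ) else 0)) := by
    intro d
    refine Finset.sum_congr rfl fun b _ => ?_
    simp only [one_mul]
    split_ifs <;> simp
  simp only [hF]
  have hblock := typeII_block_le (y := y) (M := M) (V₀ := 0) hP hw Dset hlog one_pos
    (HTII M 0 hMlo hMhi) (fun b => if b ≤ U * U then cU U b else 0) (fun _ => (1 : ℝ))
    (fun b hb => by
      split_ifs with hbU
      · rw [Finset.mem_Ioc] at hb
        have hb1 : 1 ≤ b := by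
          have : 1 ≤ M := Nat.le_mul_of_pos_right U (by positivity) |>.trans' hU; omega
        refine (abs_cU_le_log U b).trans (Real.log_le_log (by exact_mod_cast hb1) ?_)
        exact_mod_cast hbU.trans hUU
      · simp [hlog.le])
    (fun t _ => by simp)
  simpa only [mul_one] using hblock

/-- **The Type-II piece `T₃`** (`G_U ⋆ F_U`: `m, n > U`, `mn ≤ y`).  For `16 ≤ x`, `y ≤ x`,
`1 ≤ U ≤ y`, `ρ(x^{1/3−δ}+1) ≤ U`, `2 max(U, √y) ≤ x^{2/3}`, `exp(log x/log log x) ≤ N`, and the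
hyperbolic Type-II bound `HTII` (uniform `X₂ ≥ 0`):
`∑_d |∑_{U<m≤y} G_U(m) ∑_{U<n≤y/m} Λ(n) h_d(mn)| ≤ 2 (Nat.log 2 x + 1) (log x)² X₂`. -/
theorem sum_abs_T3_le {x y U P N : ℕ} (hP : P = primorial (N - 1)) {w₀ ρ δ : ℝ} (hw : w₀ ≤ N)
    (hx : (16 : ℝ) ≤ x) (hyx : y ≤ x) (hU : 1 ≤ U) (hUy : U ≤ y)
    (hUlo : ρ * ((x : ℝ) ^ (1 / 3 - δ) + 1) ≤ U)
    (hShi : 2 * ((max U (Nat.sqrt y) : ℕ) : ℝ) ≤ (x : ℝ) ^ (2 / 3 : ℝ))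
    (hN : Real.exp (Real.log x / Real.log (Real.log x)) ≤ N)
    (Dset : Finset ℕ) {X₂ : ℝ} (hX₂ : 0 ≤ X₂)
    (HTII : ∀ M V₀ : ℕ, ρ * ((x : ℝ) ^ (1 / 3 - δ) + 1) ≤ M → 2 * (M : ℝ) ≤ (x : ℝ) ^ (2 / 3 : ℝ) →
      ∀ α β : ℕ → ℝ, (∀ n, |α n| ≤ 1) → (∀ n, |β n| ≤ 1) →
      (∀ n, α n ≠ 0 → ∀ p ∈ n.primeFactors, w₀ ≤ (p : ℝ)) →
      (∀ n, β n ≠ 0 → ∀ p ∈ n.primeFactors, w₀ ≤ (p : ℝ)) →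
      ∑ d ∈ Dset, |∑ m ∈ Ioc M (2 * M), ∑ n ∈ Ioc V₀ (y / m),
        α m * β n * (if d ∣ m * n + 2 then (liouville (m * n + 2) : ℝ) else 0)| ≤ X₂) :
    ∑ d ∈ Dset, |∑ m ∈ Ioc U y, gU U m * ∑ n ∈ Ioc U (y / m), vonMangoldt n *
        ((if Nat.Coprime (m * n) P then (1 : ℝ) else 0) *
          (if d ∣ m * n + 2 then (liouville (m * n + 2) : ℝ) else 0))| ≤
      2 * ((Nat.log 2 x + 1 : ℕ) : ℝ) * (Real.log x ^ 2 * X₂) := by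
  classical
  have hx2 : (2 : ℝ) ≤ x := by linarith
  have hx2' : 2 ≤ x := by exact_mod_cast hx2
  have hlog : 0 < Real.log x := Real.log_pos (by linarith)
  set S' : ℕ := max U (Nat.sqrt y) with hS'
  have hUS' : U ≤ S' := le_max_left _ _
  have hS'y : S' ≤ y := max_le hUy (Nat.sqrt_le_self y)
  set hfun : ℕ → ℕ → ℝ := fun d k => (if Nat.Coprime k P then (1 : ℝ) else 0) *
    (if d ∣ k + 2 then (liouville (k + 2) : ℝ) else 0) with hhfun
  -- coefficient bounds
  have hΛ : ∀ n ∈ Icc 1 y, |vonMangoldt n| ≤ Real.log x := by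
    intro n hn
    rw [Finset.mem_Icc] at hn
    rw [abs_of_nonneg ArithmeticFunction.vonMangoldt_nonneg]
    exact ArithmeticFunction.vonMangoldt_le_log.trans
      (Real.log_le_log (by exact_mod_cast hn.1) (by exact_mod_cast hn.2.trans hyx))
  have hgU : ∀ m, m ≤ y → |(if Nat.Coprime m P then gU U m else 0)| ≤ Real.log x := by
    intro m hmy
    split_ifs with hmP
    · rcases Nat.eq_zero_or_pos m with rfl | hm0
      · rw [gU_eq_zero_of_le (Nat.zero_le U)]; simp [hlog.le]
      · refine (abs_gU_le U m).trans ?_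
        rw [ArithmeticFunction.sigma_zero_apply]
        exact card_divisors_le_log_of_rough hx (by omega) (hmy.trans hyx) hN (hP ▸ hmP)
    · simp [hlog.le]
  -- the roughness indicator of the product kills non-rough outer/inner variables
  have hind : ∀ d m n : ℕ, hfun d (m * n) =
      (if Nat.Coprime m P then (1 : ℝ) else 0) * hfun d (m * n) := by
    intro d m n
    simp only [hhfun]
    by_cases hmn : Nat.Coprime (m * n) P
    · rw [if_pos hmn, if_pos (Nat.Coprime.coprime_mul_right hmn)]; ring
    · rw [if_neg hmn]; ring
  -- split the outer range at `S'`
  have hsplit : ∀ d, ∑ m ∈ Ioc U y, gU U m * ∑ n ∈ Ioc U (y / m), vonMangoldt n * hfun d (m * n) =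
      ∑ m ∈ Ioc U S', gU U m * ∑ n ∈ Ioc U (y / m), vonMangoldt n * hfun d (m * n) +
      ∑ n ∈ Ioc U y, vonMangoldt n * ∑ m ∈ Ioc S' (y / n), gU U m * hfun d (n * m) := by
    intro d
    rw [← Finset.sum_Ioc_consecutive _ hUS' hS'y]
    congr 1
    calc ∑ m ∈ Ioc S' y, gU U m * ∑ n ∈ Ioc U (y / m), vonMangoldt n * hfun d (m * n)
        = ∑ m ∈ Ioc S' y, ∑ n ∈ Ioc U (y / m), gU U m * (vonMangoldt n * hfun d (m * n)) :=
          Finset.sum_congr rfl fun m _ => Finset.mul_sum _ _ _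
      _ = ∑ n ∈ Ioc U y, ∑ m ∈ Ioc S' (y / n), gU U m * (vonMangoldt n * hfun d (m * n)) :=
          sum_hyperbolic_comm S' U y _
      _ = _ := by
          refine Finset.sum_congr rfl fun n _ => ?_
          rw [Finset.mul_sum]
          refine Finset.sum_congr rfl fun m _ => ?_
          rw [mul_comm n m]; ring
  -- Part A
  have hA : ∑ d ∈ Dset, |∑ m ∈ Ioc U S', gU U m * ∑ n ∈ Ioc U (y / m), vonMangoldt n * hfun d (m * n)| ≤
      ((Nat.log 2 S' + 1 : ℕ) : ℝ) * (Real.log x * Real.log x * X₂) := by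
    refine sum_abs_dyadic_le hU Dset (fun d m => gU U m * ∑ n ∈ Ioc U (y / m),
      vonMangoldt n * hfun d (m * n)) (by positivity) fun j hj => ?_
    set M : ℕ := U * 2 ^ j with hM
    have hMlo : ρ * ((x : ℝ) ^ (1 / 3 - δ) + 1) ≤ M :=
      hUlo.trans (by exact_mod_cast Nat.le_mul_of_pos_right U (by positivity))
    have hMhi : 2 * (M : ℝ) ≤ (x : ℝ) ^ (2 / 3 : ℝ) :=
      le_trans (by exact_mod_cast Nat.mul_le_mul_left 2 hj.le) hShi
    have hF : ∀ d, ∑ m ∈ Ioc M (2 * M), (if m ≤ S' then gU U m * ∑ n ∈ Ioc U (y / m),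
        vonMangoldt n * hfun d (m * n) else 0) =
        ∑ m ∈ Ioc M (2 * M), (if m ≤ S' ∧ Nat.Coprime m P then gU U m else 0) *
          ∑ n ∈ Ioc U (y / m), vonMangoldt n * hfun d (m * n) := by
      intro d
      refine Finset.sum_congr rfl fun m _ => ?_
      by_cases hmS : m ≤ S'
      · rw [if_pos hmS]
        by_cases hmP : Nat.Coprime m P
        · rw [if_pos ⟨hmS, hmP⟩]
        · rw [if_neg (fun h => hmP h.2), zero_mul]
          convert (mul_zero (gU U m)) using 2
          refine Finset.sum_eq_zero fun n _ => ?_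
          rw [hind d m n, if_neg hmP]; ring
      · rw [if_neg hmS, if_neg (fun h => hmS h.1), zero_mul]
    simp only [hF]
    have := typeII_block_le (y := y) (M := M) (V₀ := U) hP hw Dset hlog hlog (HTII M U hMlo hMhi)
      (fun m => if m ≤ S' ∧ Nat.Coprime m P then gU U m else 0) (fun n => vonMangoldt n)
      (fun m _ => by
        by_cases h : m ≤ S' ∧ Nat.Coprime m P
        · rw [if_pos h]; have := hgU m (h.1.trans hS'y); rw [if_pos h.2] at this; exact this
        · rw [if_neg h]; simp [hlog.le])
      hΛ
    simpa only [hhfun] using this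
  -- Part B: restrict the outer range to `n ≤ S₂ := max U (y / (S'+1))`, then dyadic
  set S₂ : ℕ := max U (y / (S' + 1)) with hS₂
  have hS₂S' : S₂ ≤ S' := by
    refine max_le hUS' ?_
    have hs := Nat.lt_succ_sqrt y  -- `y < (sqrt y + 1)^2`-type
    have h1 : y / (S' + 1) ≤ y / (Nat.sqrt y + 1) := Nat.div_le_div_left (by omega) (by omega)
    refine h1.trans (le_trans ?_ (le_max_right U (Nat.sqrt y)))
    refine Nat.lt_succ_iff.mp ((Nat.div_lt_iff_lt_mul (by omega)).2 ?_)
    have := Nat.lt_succ_sqrt y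
    nlinarith
  have hB : ∑ d ∈ Dset, |∑ n ∈ Ioc U y, vonMangoldt n * ∑ m ∈ Ioc S' (y / n), gU U m * hfun d (n * m)| ≤
      ((Nat.log 2 S₂ + 1 : ℕ) : ℝ) * (Real.log x * Real.log x * X₂) := by
    -- terms with `n > S₂` vanish (empty inner range)
    have hres : ∀ d, ∑ n ∈ Ioc U y, vonMangoldt n * ∑ m ∈ Ioc S' (y / n), gU U m * hfun d (n * m) =
        ∑ n ∈ Ioc U S₂, vonMangoldt n * ∑ m ∈ Ioc S' (y / n), gU U m * hfun d (n * m) := by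
      intro d
      symm
      refine Finset.sum_subset (Finset.Ioc_subset_Ioc_right ((hS₂S').trans hS'y)) fun n hn hnS => ?_
      rw [Finset.mem_Ioc] at hn
      rw [Finset.mem_Ioc, not_and, not_le] at hnS
      have hnS₂ : S₂ < n := hnS hn.1
      have : Ioc S' (y / n) = ∅ := by
        refine Finset.Ioc_eq_empty_of_le ?_
        have h1 : y / (S' + 1) < n := lt_of_le_of_lt (le_max_right _ _) hnS₂
        -- `y / n ≤ S'` iff `y < (S'+1) n`
        refine Nat.lt_succ_iff.mp ((Nat.div_lt_iff_lt_mul (by omega)).2 ?_)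
        have := (Nat.div_lt_iff_lt_mul (by omega : 0 < S' + 1)).1 h1
        rw [mul_comm] at this; exact this
      rw [this, Finset.sum_empty, mul_zero]
    simp only [hres]
    refine sum_abs_dyadic_le hU Dset (fun d n => vonMangoldt n * ∑ m ∈ Ioc S' (y / n),
      gU U m * hfun d (n * m)) (by positivity) fun j hj => ?_
    set M : ℕ := U * 2 ^ j with hM
    have hMlo : ρ * ((x : ℝ) ^ (1 / 3 - δ) + 1) ≤ M :=
      hUlo.trans (by exact_mod_cast Nat.le_mul_of_pos_right U (by positivity))
    have hMhi : 2 * (M : ℝ) ≤ (x : ℝ) ^ (2 / 3 : ℝ) :=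
      le_trans (by exact_mod_cast Nat.mul_le_mul_left 2 (hj.le.trans hS₂S')) hShi
    have hF : ∀ d, ∑ n ∈ Ioc M (2 * M), (if n ≤ S₂ then vonMangoldt n * ∑ m ∈ Ioc S' (y / n),
        gU U m * hfun d (n * m) else 0) =
        ∑ n ∈ Ioc M (2 * M), (if n ≤ S₂ then vonMangoldt n else 0) *
          ∑ m ∈ Ioc S' (y / n), (if Nat.Coprime m P then gU U m else 0) * hfun d (n * m) := by
      intro d
      refine Finset.sum_congr rfl fun n _ => ?_
      split_ifs with hnS
      · congr 1
        refine Finset.sum_congr rfl fun m _ => ?_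
        by_cases hmP : Nat.Coprime m P
        · rw [if_pos hmP]
        · rw [if_neg hmP, zero_mul]
          rw [mul_comm n m, hind d m n, if_neg hmP]; ring
      · rw [zero_mul]
    simp only [hF]
    have := typeII_block_le (y := y) (M := M) (V₀ := S') hP hw Dset hlog hlog (HTII M S' hMlo hMhi)
      (fun n => if n ≤ S₂ then vonMangoldt n else 0) (fun m => if Nat.Coprime m P then gU U m else 0)
      (fun n hn => by
        split_ifs with hnS
        · refine hΛ n ?_
          rw [Finset.mem_Ioc] at hn; rw [Finset.mem_Icc]
          exact ⟨by omega, hnS.trans (hS₂S'.trans hS'y)⟩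
        · simp [hlog.le])
      (fun m hm => hgU m (by rw [Finset.mem_Icc] at hm; exact hm.2))
    simpa only [hhfun] using this
  -- assemble
  have hlogS' : ((Nat.log 2 S' + 1 : ℕ) : ℝ) ≤ ((Nat.log 2 x + 1 : ℕ) : ℝ) := by
    exact_mod_cast Nat.succ_le_succ (Nat.log_mono_right (hS'y.trans hyx))
  have hlogS₂ : ((Nat.log 2 S₂ + 1 : ℕ) : ℝ) ≤ ((Nat.log 2 x + 1 : ℕ) : ℝ) := by
    exact_mod_cast Nat.succ_le_succ (Nat.log_mono_right ((hS₂S'.trans hS'y).trans hyx))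
  have hpos : 0 ≤ Real.log x * Real.log x * X₂ := by positivity
  simp only [hhfun] at hsplit hA hB
  calc ∑ d ∈ Dset, |∑ m ∈ Ioc U y, gU U m * ∑ n ∈ Ioc U (y / m), vonMangoldt n *
          ((if Nat.Coprime (m * n) P then (1 : ℝ) else 0) *
            (if d ∣ m * n + 2 then (liouville (m * n + 2) : ℝ) else 0))|
      ≤ ∑ d ∈ Dset, (|∑ m ∈ Ioc U S', gU U m * ∑ n ∈ Ioc U (y / m), vonMangoldt n *
          ((if Nat.Coprime (m * n) P then (1 : ℝ) else 0) *
            (if d ∣ m * n + 2 then (liouville (m * n + 2) : ℝ) else 0))| +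
          |∑ n ∈ Ioc U y, vonMangoldt n * ∑ m ∈ Ioc S' (y / n), gU U m *
          ((if Nat.Coprime (n * m) P then (1 : ℝ) else 0) *
            (if d ∣ n * m + 2 then (liouville (n * m + 2) : ℝ) else 0))|) := by
        refine Finset.sum_le_sum fun d _ => ?_
        rw [hsplit d]; exact abs_add_le _ _
    _ ≤ ((Nat.log 2 S' + 1 : ℕ) : ℝ) * (Real.log x * Real.log x * X₂) +
          ((Nat.log 2 S₂ + 1 : ℕ) : ℝ) * (Real.log x * Real.log x * X₂) := by
        rw [Finset.sum_add_distrib]; exact add_le_add hA hB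
    _ ≤ 2 * ((Nat.log 2 x + 1 : ℕ) : ℝ) * (Real.log x ^ 2 * X₂) := by
        rw [sq]; nlinarith [mul_le_mul_of_nonneg_right hlogS' hpos, mul_le_mul_of_nonneg_right hlogS₂ hpos]

end Summit.Parity.GeneralizedHardyLittlewood.Theorems
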